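import Summits.QuantumFields.YangMills.Theorems.BalabanUVNodesN06D2SupPrechainV2AtPinsPUWQJ
import Literature.MathematicalPhysics.QuantumFieldTheory.Balaban1983to89.B9Eq3133SlotAHZ
import Literature.MathematicalPhysics.QuantumFieldTheory.Balaban1983to89.B9Eq3132ClassLetterFromNu
import Literature.MathematicalPhysics.QuantumFieldTheory.Balaban1983to89.B9Thm313WholeQstarFromG0
import Literature.MathematicalPhysics.QuantumFieldTheory.Balaban1983to89.B9RWSums347DefiniteFacesWindow
import Literature.MathematicalPhysics.QuantumFieldTheory.Balaban1983to89.B9LettersHZAtOne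
import HarnessLib

/-!
# N06 [B9] — «P-H♭» F3: (3.133) AT SLOT (a) AT THE RECORD — the two sup members of (3.133) for `H♭ = G₀𝔮⋆(𝔮G₀𝔮⋆)⁻¹` (`G₀ = T₀ = Δ_a[𝔮]⁻¹`) read by def-Y's `hKernelOfOp`
# at print's KNIT bond pair and ANY site pair (`T₀` a free slot-(a) letter: `G₀` of the certificate or def-Y's `G♭`), along `f : J → MemberY …`, from the G₀-type (2.51) entries of `T₀`,
# the knit `Q⋆` letter and a displayed coercivity of `𝔮T₀𝔮⋆` — print's n = 0 term of Theorem 3.12's proof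

Cell `pub-ymgap` (HUMAN RULING D-0062, Track A), node N06 = [Balaban1985BackgroundPropagators] («[B9]»); seat `pub-ymgap-dag-n06-l` (g42), 2026-08-31; node00-def-Y g39's (J1)
RULING («the slot-(a) (3.133) row is yours to pen … by the METHOD of Thm 3.12»); consumer = def-Y's owed readback `H♭_OpsY ↔ H1OfRecordAtBgFlat` feeding dag-n07-e's displayed
`B9.Thm312Printed … h1KernelRecN00 …` (⟹ (ℓa-H) ✓p826224 + (KL-H) ✓p826573 ⟹ PT-B's node-00 Prop. 4 door ✓p826691).  `--supports stmt-QuantumFields-27239 --as helper`; count-neutral.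
[4] = [Balaban1984PropagatorsII].

THE PRINT.  [B9] p. 422 «The above inequality [(3.132)] together with Theorem 3.3 for G … give |H_{μν}(x, y′)|, |∇H_{μν}(x, y′)| … ≦ O(1)[1, (Lʲη)⁻¹, …](L^{j′}η)^{−d}
e^{−½δ₁d(y,y′)} … (3.133)»; p. 421 «G₀ = (Δ + DRD* + Q*aQ)⁻¹ … G = G₀ Σ (Δ′_πG₀)ⁿ (3.130)»; p. 420 (3.126); p. 398 remark; [4] Lemma 2.1 (2.60)–(2.61) p. 234, (2.51) p. 232.

WHAT.  ★★★ `ineq3133flat_of_pins_knit_J` — for every `f : J → MemberY …`: `∃ M₄ a₄ C δ₁ > 0` such that at every `j` above `M₄`, every `0 < α₀` (`M·α₀ ≤ a₄`), every `U` of the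
(3.35)∩(3.36) class, and every `n ∈ {0,1}`, `y`, `y′`:
`(hKernelOfOp (f j).toKIdx (bg9YR …) id (U ↦ T₀ U ∘ 𝔮⋆ U ∘ (𝔮 T₀ 𝔮⋆)⁻¹ U) parH).e n U y y′ ≤ C·(Lʲη)^{−n}(L^{j′}η)^{−(d+1)}e^{−(δ₁∕2)d(y,y′)}` — the SUP CONJUNCT of `B9.Ineq3133` for the
slot-(a) minimizer map in def-Y's reading.  FROM (all displayed hypotheses ∕ theorems of the certificate of record, binder names of ✓`…D2SupPrechainV2AtPinsPUWQJ` ∕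
✓`…Thm312313AtPinsStateSUCLEParGJ`): the G₀ layer's (2.51) entries `he0` (Thm 3.3 (3.42)₀ for `G₀`), `he1` (the `∇_U∘G₀` hom-entry), the knit `Q⋆` letter `hqsK`, the pins
`hblk12 hblkY12 hblkZ12 hG0co12 hDco12` + ONE NEW PIN `hQsco12q : (𝔬12 x).Qstar U = QscoKHq … (𝔮s x) U` (the knit twin of `hQsco12`), the carrier-faithfulness `hβI` of `bI`, and
a DISPLAYED coercivity `hcoA : CoerciveUnder … (𝔮T₀𝔮⋆)` along `f` (SITE-PAIR-GENERIC per node00-def-Y's (ρ♭) word 2026-08-31: at the certificate's block-average site pair it is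
✓`…Eq3132CoerciveVariationalQJ.hcoA_of_testFamily_QR_J` on ROW 17 + ✓`hTt_knit_of_pins` — cf. this seat's ✓`…N06Eq3132SlotAKnitQJ`; at the CENTRES pair of the K0ᴬ letter `H1OfRecordAtBgFlat` it is the
Thm-3.11-type row for def-Y's `Δ_a♭` (owed) — and the knit regime rows `hc hRP hα′ hαQ haK hKpl` of the decay producer).
CHAIN (by name): `he0` ⟹ `DecayUnder` (✓`…Eq3132DecayFromMajorantKnitQJ.decayUnder_QGQOfQY_knit_of_majorants_R_J` at `T := T₀`) + `hcoA` ⟹ ROW 26 at slot (a)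
(✓`B9Eq3132NuReadingRJ.stmt3132Printed_nu_of_coercive_decay_R_J`) ⟹ class letter `c2♭` (✓`B9Eq3132ClassLetterFromNu.hasMaj_cNorm_weightNorm_coordOpK_geo9Y_of_ineq3132Nu`); `he0 + hqsK` ⟹ `gQs2` (✓`gQs2_of_e0`),
`he1 + hqsK` ⟹ `dgQs` (✓`dgQs_of_e1`); the model identity `HcoK(H♭) = GcoK(T₀) ∘ QscoKHq(𝔮⋆) ∘ (c•coordOpK(C♭))` (§1, pattern of def-Y's ✓`HcoK_HDY_eq`); the co-readings
✓`coRealizesHRel_hKernel_coords_zero ∕ _one` (dag-n06-d); [4] (2.61) ✓`rowSum261_geo9Y`, (2.60) ✓`scaleTransfer_rpow_geo9Y`; assembly ✓`B9Eq3133SlotAHZ.ineq3133flat_sup_of_lettersZ_rel`.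
RATES: `δ⋆ := min δ12₀ (min δQ (δ₁♭∕2))`, row sum at `δ⋆∕4`, letters at `δ⋆∕2`, entries at `δ⋆∕4`, transfer at `α = ½` ⟹ printed rate `δ₁ := δ⋆∕4` (so `e^{−(δ⋆∕8)d}`).

HONEST FRAMING.  Kernel bookkeeping over landed modules; every analytic input (G₀ layer = Thm 3.3 for `G₀` from the cube tables, the knit `Q⋆` letter, ROW 17, the regime
rows ∕ numerics) is a displayed HYPOTHESIS of the certificate or one of its theorems; nothing of [B9] asserted; the Hölder member of (3.133) not treated; the readback OpsY ↔
BgScheme stays def-Y's; count-neutral; N06 NOT discharged; K0ᴬ∕K1ᴬ not closed; one finite `𝕋⁴` programme at fixed ε — nothing continuum ∕ OS ∕ Clay; **the Yang–Mills mass gap is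
NOT proved.**  0 `def`, 0 `sorry`; NEW file.
-/

noncomputable section

namespace Summit.QuantumFields.YangMills.BalabanUVNodes.N06Ineq3133SlotAAtPinsKnitQJ

open Literature.MathematicalPhysics.QuantumFieldTheory.Balaban1983to89 open Literature.MathematicalPhysics.QuantumFieldTheory.Balaban1983to89.Node00 (FBondY IBondY SiteY CfgY SiteParY SiteOpY parSymY GpY GpPhysY BondOpY parBY BondParY) open Literature.MathematicalPhysics.QuantumFieldTheory.Balaban1983to89.Node00.OpsYSectDCoords (DvcoKH DvscoKH TpicoK T2coK cR39_trBasis_pos) open B9Thm39ReadingCoords (cR39 coordBound39 basisBound39) open B9Thm34Ext (toB6) open B11SectG (HasMaj BlockNorm) open B9Thm312Whole (cNorm GeoOK) open B9Thm312WholeClasses (cNormR rwt rwt_nonneg) open B9CoReadingCoords (XBK blkBK coordOpK cdBₗ) open B9CoReadingCoordsS (XSK sIK blkSK GcoS) open B9CoReadingCoordsH (XHK) open B9CoReadingCoordsTranspose (TrIdx trBasis) open B9PinMembersKLevelV1 (MemberY geo9Y) open B9BackgroundsKLevelV1R (RegFamY bg9YR MemOfFam) open B9GeoLemma21KLevelV1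 (geo9Y_len_pos geo9Y_dist_triangle geo9Y_dist_comm) open B9GeoNormsKLevelV1 (geo9K geo9K_dist_nonneg) open B7Prop2SpecialUnitary (specialUnitaryUnits) open B9PerturbationMajorantAlgebra (Proj349Maj Thm31GpMaj hasMaj_weaken) open B9PerturbationMajorantsAtLetters (PcoK) open B9MultiscaleSmoothPartitionYNear (rNear) open B9MultiscaleSmoothPartitionYLip (CLip CLip_nonneg) open B9SmoothHolderClassP (bHZKP bHZKPG bHZPG) open B9GradViaDivLettersTransported (taxiB taxiS) open B9PerturbationSplitAtLetters (TaLcoK TbLcoKH Ta2LcoK Tb2LcoKH) open B9PerturbationL2Delta2 (D2coK) open B9SmoothHolderClassPProducers (CTel CTel_nonneg) open B9RowSum261DefiniteFaces (rowConst261 rowConst261_nonneg) open B9SectDSup (weightNorm) open B6RandomWalk (HasMajorant) open B6RandomWalkHom (HasMajorantHom) open B9Thm312WholeStepRegular (StepS LettersS3131) open B9CoReadingCoordsHolder (PK) open B9CoReadingCoordsHolderAdm (holderProbesKA) open B9RWSums343Holder (HolderProbes) open B9PerturbationMajorantAlgebra (CurrentMaj) open B9PerturbationMajorantsAtLetters (BcoKH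 BdcoKH) open B9Thm313WholeDir (Thm33G0DirR) open B9Thm313WholeDirInputBC (Letters313IML) open B9LettersHZAtOne (plateau_pos) open B9CoReadingCoordsInput (bHK) open B9CoReadingCoordsInputS (bHS) open B9CoRealizesRelAtLetters (RelB) open B9Thm33G0ProbeZeroAtCutPins (pX0_of_pins) open B6GlobalChartV1 (blkV1) open B6Ineq2142KLevelV1 (β lvl) open B6Geom246MultiLevelTorus (geomT) open Summit.QuantumFields.YangMills.BalabanUVNodes.N06HolderPinsGradedAtRecord (links_le_one) open Summit.QuantumFields.YangMills.BalabanUVNodes.N06TbHLegAtPinsPhysPU (htbH_of_pinsP43_geo9Y) open Summit.QuantumFields.YangMills.BalabanUVNodes.N06LettersSAtPinsPU (hLettersS_of_pinsP44_geo9Y) open Summit.QuantumFields.YangMills.BalabanUVNodes.N06StateClassFactsAtPinsPU (hStateFacts_of_pinsP_geo9Y) open Summit.QuantumFields.YangMills.BalabanUVNodes.N06StateProducerG0AtPinsPU (hG0S2_of_pinsP_geo9Y) open Summit.QuantumFields.YangMills.BalabanUVNodes.N06StateProducersAAtPinsPU (hProducersA_of_pinsP_geo9Y) open Summit.QuantumFields.YangMills.BalabanUVNodes.N06StateProducersBAtPinsPUW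 (hProducersBW_of_pinsP_geo9Y) open Summit.QuantumFields.YangMills.BalabanUVNodes.N06StatePairsAtPinsPU (hStatePairs_of_pinsP_geo9Y) open Summit.QuantumFields.YangMills.BalabanUVNodes.N06StateAssemblyAtPinsPUW (hStateAssemblyW_of_faces)
open scoped Matrix.Norms.L2Operator
open Summit.QuantumFields.YangMills.BalabanUVNodes.N06GDSupSubLegAtPinsPUWIPar (gdsup_sub_of_pins_inv_par) open Literature.MathematicalPhysics.QuantumFieldTheory.Balaban1983to89.Node00 (deltaAQY parBY_mem QGQOfQY GDQY QGQinvQY delta2OfQY) open Literature.MathematicalPhysics.QuantumFieldTheory.Balaban1983to89.Node00.OpsYOps312OfRecordPar (S0coKq QcoKHq CcoKq) open Literature.MathematicalPhysics.QuantumFieldTheory.Balaban1983to89.Node00.OpsYSectDCoordsQ (S0coKq_sub_TpicoK_mul_GcoK_GDQY) open Literature.MathematicalPhysics.QuantumFieldTheory.Balaban1983to89.B9B8AveragingJunction (parKnitY) open Literature.MathematicalPhysics.QuantumFieldTheory.Balaban1983to89.B9Thm311ReadingCoords (IsAdjTr IsSymmTr PosDefTr) open Literature.MathematicalPhysics.QuantumFieldTheory.Balaban1983to89.B9Eq316AveragingTransposeZd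 (alphaQ) open Literature.MathematicalPhysics.QuantumFieldTheory.Balaban1983to89.B9C2FormBoxRegimeY (Kpl) open Literature.MathematicalPhysics.QuantumFieldTheory.Balaban1983to89.B9Eq3115KnitLetterYOnto (kCol) open Literature.MathematicalPhysics.QuantumFieldTheory.Balaban1983to89.B9Eq3132TentBumps (Cth) open Literature.MathematicalPhysics.QuantumFieldTheory.Balaban1983to89.B7Prop2Explicit (C0 c2') open Literature.MathematicalPhysics.QuantumFieldTheory.Balaban1983to89.B9BackgroundsKLevelV1P (bg9KP) open Literature.MathematicalPhysics.QuantumFieldTheory.Balaban1983to89.B6KLevelCensusIndexV1 (kGeo) open Literature.MathematicalPhysics.QuantumFieldTheory.Balaban1983to89.B9Eq3132ClassLetterFromNu (hasMaj_cNorm_weightNorm_coordOpK_geo9Y_of_ineq3132Nu) open Literature.MathematicalPhysics.QuantumFieldTheory.Balaban1983to89.B9LettersZCFieldsAtPins (const3132_le) open Literature.MathematicalPhysics.QuantumFieldTheory.Balaban1983to89.B9Thm39ReadingCoords (abs_repr_le) open Literature.MathematicalPhysics.QuantumFieldTheory.Balaban1983to89.B7Prop2SpecialUnitary (specialUnitaryUnits_le_unitaryUnits)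 open Summit.QuantumFields.YangMills.BalabanUVNodes.N06Eq3132DecayFromMajorantKnitQ (decayUnder_QGQOfQY_knit_of_majorants_R) open Summit.QuantumFields.YangMills.BalabanUVNodes.N06Eq3132CoerciveFromGAKnitQ (coerciveUnder_of_subMajorants_knit_R) open Summit.QuantumFields.YangMills.BalabanUVNodes.N06Eq3132CoerciveVariationalQ (hcoA_of_testFamily_QR) open Summit.QuantumFields.YangMills.BalabanUVNodes.N06Eq3132KnitTestFamilyQ (hTt_knit_of_pins) open Summit.QuantumFields.YangMills.BalabanUVNodes.N06SectDUnitsAtPinsPhysQ (isUnit_deltaPiAQY_of_formSmall) open Summit.QuantumFields.YangMills.BalabanUVNodes.N06D2SupLegAtPinsPUWQ (d2sup_of_pins_q) open Literature.MathematicalPhysics.QuantumFieldTheory.Balaban1983to89.B9Eq3132NuReadingR (stmt3132Printed_nu_of_coercive_decay_R) open Literature.MathematicalPhysics.QuantumFieldTheory.Balaban1983to89.B9Eq3132StepDifference (GcoK_sub) open Literature.MathematicalPhysics.QuantumFieldTheory.Balaban1983to89.B9LettersZCFieldsAtPinsB (c2_pinsB) open Literature.MathematicalPhysics.QuantumFieldTheory.Balaban1983to89.B9Thm311ReadingCoords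 (PosDefTr) open Literature.MathematicalPhysics.QuantumFieldTheory.Balaban1983to89.B9BackgroundsKLevelV1R (regY335 regY336) open Literature.MathematicalPhysics.QuantumFieldTheory.Balaban1983to89.B9RWSumsReadsNbr (nbr) open Literature.MathematicalPhysics.QuantumFieldTheory.Balaban1983to89.B9Ineq349SiteFromConv342 (contractive_of_mem) open Literature.MathematicalPhysics.QuantumFieldTheory.Balaban1983to89.B7Prop2SpecialUnitary (specialUnitaryUnits_le_unitaryUnits) open B9Thm39ReadingCoords (cR39_nonneg)
open Summit.QuantumFields.YangMills.BalabanUVNodes.N06D2SupLegAtPinsPUW (d2sup_of_pins) open Summit.QuantumFields.YangMills.BalabanUVNodes.N06SectDUnitsAtPinsPhys (isUnit_deltaPiAY_of_formSmall_phys) open Literature.MathematicalPhysics.QuantumFieldTheory.Balaban1983to89.Node00 (Stage3Params C2Y delta2OfY trDualMatY delta2PiY) open Literature.MathematicalPhysics.QuantumFieldTheory.Balaban1983to89.Node00.OpsYSectDCoords (S0coK CcoK S0coK_sub_TpicoK_mul_GcoK_GDY) open Literature.MathematicalPhysics.QuantumFieldTheory.Balaban1983to89.B9BackgroundsKLevelV1P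 (bg9YP) open Literature.MathematicalPhysics.QuantumFieldTheory.Balaban1983to89.B9PinGeometryKLevelV1 (c35Y) open Literature.MathematicalPhysics.QuantumFieldTheory.Balaban1983to89.B9Eq3132SectDLetters (GDY) open Literature.MathematicalPhysics.QuantumFieldTheory.Balaban1983to89.B9Thm312Whole (FormSmall PosDefEnd) open Literature.MathematicalPhysics.QuantumFieldTheory.Balaban1983to89.B9SectDL2Decay (bl2) open Literature.MathematicalPhysics.QuantumFieldTheory.Balaban1983to89.B9Thm312WholeFormSmallFromL2 (abs_form_le_of_stepBlockBd weightedL2_le_form_of_l0) open Literature.MathematicalPhysics.QuantumFieldTheory.Balaban1983to89.B11SectG (RowSum) open Literature.MathematicalPhysics.QuantumFieldTheory.Balaban1983to89.B9GeoLemma21KLevelV1 (rowSum261_geo9Y) open B9CoReadingCoords (GcoK) open B9CoReadingCoordsH (blkHK) open B9Delta2FormMajorant (C2FormMaj)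
open Summit.QuantumFields.YangMills.BalabanUVNodes.N06Eq3132KnitTestFamilyQ (hTt_knit_of_pins)
open Literature.MathematicalPhysics.QuantumFieldTheory.Balaban1983to89.B9Eq3132NuReading (siteKernelOfOpNu nuY lamInvY)
open Literature.MathematicalPhysics.QuantumFieldTheory.Balaban1983to89.B9Eq3132RingInverseReading (normMatY)
open Literature.MathematicalPhysics.QuantumFieldTheory.Balaban1983to89.B9Eq3132CTInputs (CoerciveUnder)
open Literature.MathematicalPhysics.QuantumFieldTheory.Balaban1983to89.B9Eq3132ScalarIndex (geoComap)
open Literature.MathematicalPhysics.QuantumFieldTheory.Balaban1983to89.Node00 (hKernelOfOp)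
open Literature.MathematicalPhysics.QuantumFieldTheory.Balaban1983to89.Node00.OpsYOps312OfRecordPar (QscoKHq)
open Literature.MathematicalPhysics.QuantumFieldTheory.Balaban1983to89.Node00.OpsYSectDCoords (coordOpKH_const_comp_coordOpK_const coordOpK_const_comp_coordOpKH_const cR39_trBasis_pos)
open Literature.MathematicalPhysics.QuantumFieldTheory.Balaban1983to89.B9CoReadingCoords (GcoK DcoK coordOpK)
open Literature.MathematicalPhysics.QuantumFieldTheory.Balaban1983to89.B9CoReadingCoordsH (HcoK coordOpKH blkHK coRealizesHRel_hKernel_coords_zero coRealizesHRel_hKernel_coords_one)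
open Literature.MathematicalPhysics.QuantumFieldTheory.Balaban1983to89.B9CoRealizesRelAtLetters (RelB relB_refl len_eq_of_relB dist_eq_of_relB)
open Literature.MathematicalPhysics.QuantumFieldTheory.Balaban1983to89.B9Eq3132ClassLetterFromNu (hasMaj_cNorm_weightNorm_coordOpK_geo9Y_of_ineq3132Nu)
open Literature.MathematicalPhysics.QuantumFieldTheory.Balaban1983to89.B9Thm313WholeQstarFromG0 (gQs2_of_e0 dgQs_of_e1)
open Literature.MathematicalPhysics.QuantumFieldTheory.Balaban1983to89.B9RWSums347DefiniteFacesWindow (scaleTransfer_rpow_geo9Y)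
open Literature.MathematicalPhysics.QuantumFieldTheory.Balaban1983to89.B9LettersHZAtOne (plateau_pos)
open Literature.MathematicalPhysics.QuantumFieldTheory.Balaban1983to89.B9Thm39ReadingCoords (cR39 abs_repr_le)
open Literature.MathematicalPhysics.QuantumFieldTheory.Balaban1983to89.B9Thm312Whole (GeoOK cNorm)
open Literature.MathematicalPhysics.QuantumFieldTheory.Balaban1983to89.B9SectDSup (weightNorm)
open Literature.MathematicalPhysics.QuantumFieldTheory.Balaban1983to89.B11SectG (HasMaj BlockNorm RowSum)
open Literature.MathematicalPhysics.QuantumFieldTheory.Balaban1983to89.B9GeoLemma21KLevelV1 (geo9Y_dist_triangle geo9Y_dist_comm geo9Y_len_pos rowSum261_geo9Y)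
open Literature.MathematicalPhysics.QuantumFieldTheory.Balaban1983to89.B9GeoNormsKLevelV1 (geo9K_dist_nonneg)
open Literature.MathematicalPhysics.QuantumFieldTheory.Balaban1983to89.B9GeoLemma21KLevelV1 (geo9K_one_le_L)
open Literature.MathematicalPhysics.QuantumFieldTheory.Balaban1983to89.B9Eq3133SlotAHZ (ineq3133flat_sup_of_lettersZ_rel)

variable {N : ℕ} {θ : Stage3Params} {Mstar : ℕ}

/-- scalars of a composite of scaled maps. [folklore] -/
private theorem smul_comp_smul' {X₁ X₂ X₃ : Type} (r s : ℝ) (A : (X₂ → ℝ) →ₗ[ℝ] (X₃ → ℝ)) (C : (X₁ → ℝ) →ₗ[ℝ] (X₂ → ℝ)) :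
    (r • A) ∘ₗ (s • C) = (r * s) • (A ∘ₗ C) := by
  rw [LinearMap.smul_comp, LinearMap.comp_smul, smul_smul]

/-- ★★★ **(3.133) AT SLOT (a) AT THE RECORD, ALONG `f` — THE TWO SUP MEMBERS FOR `H♭ = G₀𝔮⋆(𝔮G₀𝔮⋆)⁻¹` IN def-Y's `hKernelOfOp` READING AT THE KNIT PAIR** (module docstring).
[cite: Balaban1985BackgroundPropagators, (3.133) p.422, (3.126) p.420, (3.130) p.421, (3.132) p.422, (3.26)–(3.27) p.395, Thm 3.11 p.416, Thm 3.12 p.423, p.398; Balaban1984PropagatorsII, (2.51) p.232, Lemma 2.1 (2.60)–(2.61) p.234, (2.142) p.248, (2.150) p.249] -/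
theorem ineq3133flat_of_pins_knit_J [NeZero N] [∀ x : MemberY θ.d₆ θ.ℓ₆ θ.hd' θ.hL' θ.b₀ θ.b₁ Mstar, Fintype (geo9Y x).Site]
    [∀ x : MemberY θ.d₆ θ.ℓ₆ θ.hd' θ.hL' θ.b₀ θ.b₁ Mstar, DecidableEq (geo9Y x).Site]
    {R₁ R₂ : RegFamY θ.d₆ θ.ℓ₆ θ.hd' θ.hL' θ.b₀ θ.b₁ Mstar (Matrix (Fin N) (Fin N) ℂ)} (H : MemberY θ.d₆ θ.ℓ₆ θ.hd' θ.hL' θ.b₀ θ.b₁ Mstar → Prop) {J : Type} (f : J → MemberY θ.d₆ θ.ℓ₆ θ.hd' θ.hL' θ.b₀ θ.b₁ Mstar)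
    (bI : ∀ x : MemberY θ.d₆ θ.ℓ₆ θ.hd' θ.hL' θ.b₀ θ.b₁ Mstar, FBondY x.toKIdx → IBondY x.toKIdx)
    (hlev : ∀ (x : MemberY θ.d₆ θ.ℓ₆ θ.hd' θ.hL' θ.b₀ θ.b₁ Mstar) (f : FBondY x.toKIdx), lvl x.hN x.D x.hk (bI x f) = (blkV1 x.hN x.D f).1.1)
    (hβ1 : ∀ (x : MemberY θ.d₆ θ.ℓ₆ θ.hd' θ.hL' θ.b₀ θ.b₁ Mstar) (f : FBondY x.toKIdx), (geomT x.D).dist (β x.hN x.D x.hk (bI x f)) (blkV1 x.hN x.D f) ≤ 1)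
    (hβI : ∀ (x : MemberY θ.d₆ θ.ℓ₆ θ.hd' θ.hL' θ.b₀ θ.b₁ Mstar) (fb : FBondY x.toKIdx) (cc : IBondY x.toKIdx), blkV1 x.hN x.D fb = β x.hN x.D x.hk cc → β x.hN x.D x.hk (bI x fb) = blkV1 x.hN x.D fb)
    {mN : ℕ} (hnbr : ∀ (x : MemberY θ.d₆ θ.ℓ₆ θ.hd' θ.hL' θ.b₀ θ.b₁ Mstar) (y : (geo9Y x).Site), (nbr (geo9Y x) ((θ.ℓ₆ : ℝ) + 4) y).card ≤ mN)
    (c : ℝ)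
    -- print's knit averaging pair and the slot-(a) form `Δ_a[𝔮]`, `T₀ = Δ_a[𝔮]⁻¹ = G₀`; a bond transporter for the (unread) Hölder slot of the reading
    (𝔮 : ∀ x : MemberY θ.d₆ θ.ℓ₆ θ.hd' θ.hL' θ.b₀ θ.b₁ Mstar, Node00.OpsYQLetter.QLetterY (Matrix (Fin N) (Fin N) ℂ) x.toKIdx)
    (𝔮s : ∀ x : MemberY θ.d₆ θ.ℓ₆ θ.hd' θ.hL' θ.b₀ θ.b₁ Mstar, Node00.OpsYQLetter.QsLetterY (Matrix (Fin N) (Fin N) ℂ) x.toKIdx)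
    (h𝔮 : ∀ (x : MemberY θ.d₆ θ.ℓ₆ θ.hd' θ.hL' θ.b₀ θ.b₁ Mstar) (U : CfgY (Matrix (Fin N) (Fin N) ℂ) x.toKIdx), 𝔮 x U = B9Eq3115KnitLetterY.QknitY x.toKIdx U)
    (h𝔮s : ∀ (x : MemberY θ.d₆ θ.ℓ₆ θ.hd' θ.hL' θ.b₀ θ.b₁ Mstar) (U : CfgY (Matrix (Fin N) (Fin N) ℂ) x.toKIdx), 𝔮s x U = Node00.OpsYQLetter.adjTrY (B9Eq3115KnitLetterY.QknitY x.toKIdx U))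
    (T₀ : ∀ x : MemberY θ.d₆ θ.ℓ₆ θ.hd' θ.hL' θ.b₀ θ.b₁ Mstar, BondOpY (Matrix (Fin N) (Fin N) ℂ) x.toKIdx)
    (parH : ∀ x : MemberY θ.d₆ θ.ℓ₆ θ.hd' θ.hL' θ.b₀ θ.b₁ Mstar, BondParY (Matrix (Fin N) (Fin N) ℂ) x.toKIdx)
    -- the knit regime rows (numerics + the (3.35) class bridge)
    {c₀ : ℝ} (hc : c₀ ≤ 10)
    (hRP : ∀ (x : MemberY θ.d₆ θ.ℓ₆ θ.hd' θ.hL' θ.b₀ θ.b₁ Mstar) (α₀ : ℝ) (U : (bg9YR (Matrix (Fin N) (Fin N) ℂ) (specialUnitaryUnits (Fin N)) R₁ R₂ x).Cfg),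
      (bg9YR (Matrix (Fin N) (Fin N) ℂ) (specialUnitaryUnits (Fin N)) R₁ R₂ x).Reg335 c α₀ U → (bg9KP (Matrix (Fin N) (Fin N) ℂ) (specialUnitaryUnits (Fin N)) x.toKIdx).Reg335 c₀ α₀ U)
    {α₀' : ℝ} (hα' : 0 < α₀') (hαQ : α₀' ≤ alphaQ (θ.d₆ + 1) (θ.ℓ₆ + 1))
    {aK : ℝ} (haK : 0 < aK)
    (hKpl : ∀ (x : MemberY θ.d₆ θ.ℓ₆ θ.hd' θ.hL' θ.b₀ θ.b₁ Mstar) (a : ℝ), 0 ≤ a → a ≤ aK → Kpl x.toKIdx a * (kGeo x.toKIdx).L ^ 4 < α₀')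
    -- the G₀-layer walk model `𝔬12` (block maps, `G0`, `D`, `Qstar` slots) and its pins at the knit record
    (𝔬12 : ∀ x : MemberY θ.d₆ θ.ℓ₆ θ.hd' θ.hL' θ.b₀ θ.b₁ Mstar, B9Thm312Whole.Ops (geo9Y x) (bg9YR (Matrix (Fin N) (Fin N) ℂ) (specialUnitaryUnits (Fin N)) R₁ R₂ x) (XBK (TrIdx N) x.toKIdx) (XBK (TrIdx N) x.toKIdx) (XHK (TrIdx N) x.toKIdx) (XSK (TrIdx N) x.toKIdx))
    (hblk12 : ∀ x : MemberY θ.d₆ θ.ℓ₆ θ.hd' θ.hL' θ.b₀ θ.b₁ Mstar, (𝔬12 x).blk = blkBK x.toKIdx (bI x)) (hblkY12 : ∀ x : MemberY θ.d₆ θ.ℓ₆ θ.hd' θ.hL' θ.b₀ θ.b₁ Mstar, (𝔬12 x).blkY = blkBK x.toKIdx (bI x))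
    (hblkZ12 : ∀ x : MemberY θ.d₆ θ.ℓ₆ θ.hd' θ.hL' θ.b₀ θ.b₁ Mstar, (𝔬12 x).blkZ = blkHK x.toKIdx)
    (hG0co12 : ∀ (x : MemberY θ.d₆ θ.ℓ₆ θ.hd' θ.hL' θ.b₀ θ.b₁ Mstar) (U : (bg9YR (Matrix (Fin N) (Fin N) ℂ) (specialUnitaryUnits (Fin N)) R₁ R₂ x).Cfg), (𝔬12 x).G0 U = GcoK x.toKIdx (trBasis N) (bg9YR (Matrix (Fin N) (Fin N) ℂ) (specialUnitaryUnits (Fin N)) R₁ R₂ x) (fun U => U) (T₀ x) U)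
    (hDco12 : ∀ (x : MemberY θ.d₆ θ.ℓ₆ θ.hd' θ.hL' θ.b₀ θ.b₁ Mstar) (U : (bg9YR (Matrix (Fin N) (Fin N) ℂ) (specialUnitaryUnits (Fin N)) R₁ R₂ x).Cfg), (𝔬12 x).D U = DcoK x.toKIdx (trBasis N) (bg9YR (Matrix (Fin N) (Fin N) ℂ) (specialUnitaryUnits (Fin N)) R₁ R₂ x) (fun U => U) U)
    (hQsco12q : ∀ (x : MemberY θ.d₆ θ.ℓ₆ θ.hd' θ.hL' θ.b₀ θ.b₁ Mstar) (U : (bg9YR (Matrix (Fin N) (Fin N) ℂ) (specialUnitaryUnits (Fin N)) R₁ R₂ x).Cfg), (𝔬12 x).Qstar U = QscoKHq x.toKIdx (trBasis N) (bg9YR (Matrix (Fin N) (Fin N) ℂ) (specialUnitaryUnits (Fin N)) R₁ R₂ x) (fun U => U) (𝔮s x) U)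
    -- the G₀ layer's (2.51) entries of `G₀` and `∇_U∘G₀` (Thm 3.3 (3.42)₀, (3.42)₁-hom for `G₀`), member-wide above `(M₀, a₀)`
    {M₀ a₀ B12₀ δ12₀ : ℝ} (ha₀ : 0 < a₀) (hB12₀ : 0 ≤ B12₀) (hδ12₀ : 0 < δ12₀)
    (he0 : ∀ x : MemberY θ.d₆ θ.ℓ₆ θ.hd' θ.hL' θ.b₀ θ.b₁ Mstar, M₀ ≤ (geo9Y x).M → ∀ α₀ : ℝ, 0 < α₀ → (geo9Y x).M * α₀ ≤ a₀ → ∀ U : (bg9YR (Matrix (Fin N) (Fin N) ℂ) (specialUnitaryUnits (Fin N)) R₁ R₂ x).Cfg, (bg9YR (Matrix (Fin N) (Fin N) ℂ) (specialUnitaryUnits (Fin N)) R₁ R₂ x).Reg335 c α₀ U → (bg9YR (Matrix (Fin N) (Fin N) ℂ) (specialUnitaryUnits (Fin N)) R₁ R₂ x).Reg336 c α₀ U →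
      HasMajorant (g := toB6 (geo9Y x) 1 (H x)) (𝔬12 x).blk ((𝔬12 x).G0 U) (fun (a b : (geo9Y x).Site) => B12₀ * (geo9Y x).len a ^ 2 * Real.exp (-(δ12₀ * (geo9Y x).dist a b))))
    (he1 : ∀ x : MemberY θ.d₆ θ.ℓ₆ θ.hd' θ.hL' θ.b₀ θ.b₁ Mstar, M₀ ≤ (geo9Y x).M → ∀ α₀ : ℝ, 0 < α₀ → (geo9Y x).M * α₀ ≤ a₀ → ∀ U : (bg9YR (Matrix (Fin N) (Fin N) ℂ) (specialUnitaryUnits (Fin N)) R₁ R₂ x).Cfg, (bg9YR (Matrix (Fin N) (Fin N) ℂ) (specialUnitaryUnits (Fin N)) R₁ R₂ x).Reg335 c α₀ U → (bg9YR (Matrix (Fin N) (Fin N) ℂ) (specialUnitaryUnits (Fin N)) R₁ R₂ x).Reg336 c α₀ U →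
      HasMajorantHom (g := toB6 (geo9Y x) 1 (H x)) (𝔬12 x).blk (𝔬12 x).blkY ((𝔬12 x).D U ∘ₗ (𝔬12 x).G0 U)
        (fun (a b : (geo9Y x).Site) => B12₀ * (geo9Y x).len a * Real.exp (-(δ12₀ * (geo9Y x).dist a b))))
    -- the knit `Q⋆` letter of the heads (member-wide above `(M12, a12)`, (3.35) only)
    {M12 a12 BQ δQ : ℝ} (ha12 : 0 < a12) (hBQ : 0 ≤ BQ) (hδQ : 0 < δQ)
    (hqsK : ∀ x : MemberY θ.d₆ θ.ℓ₆ θ.hd' θ.hL' θ.b₀ θ.b₁ Mstar, M12 ≤ (geo9Y x).M → ∀ α₀ : ℝ, 0 < α₀ → (geo9Y x).M * α₀ ≤ a12 → ∀ U : (bg9YR (Matrix (Fin N) (Fin N) ℂ) (specialUnitaryUnits (Fin N)) R₁ R₂ x).Cfg, (bg9YR (Matrix (Fin N) (Fin N) ℂ) (specialUnitaryUnits (Fin N)) R₁ R₂ x).Reg335 c α₀ U →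
      HasMaj (weightNorm (BlockNorm.ofBlocks (toB6 (geo9Y x) 1 (H x)) (𝔬12 x).blkZ) (fun y => ((((θ.ℓ₆ + 1 : ℕ) : ℝ) ^ (θ.d₆ + 1)) ^ lvl x.hN x.D x.hk y)⁻¹) (fun y => (plateau_pos x.toKIdx y).le))
        (cNorm 1 (H x) (𝔬12 x).blk (fun y => (geo9Y_len_pos x y).le) 0) ((𝔬12 x).Qstar U) (fun a a' => BQ * Real.exp (-(δQ * (geo9Y x).dist a a'))))
    -- the coercivity of the normalised `𝔮 T₀ 𝔮⋆` along `f` (site-pair-generic: at the certificate's block-average pair = ✓`hcoA_of_testFamily_QR_J` on ROW 17 + ✓`hTt_knit_of_pins`;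
    -- at the centres pair of node00-def-Y's (ρ♭) it is the Thm-3.11-type row for `Δ_a♭` — displayed here)
    (hcoA : CoerciveUnder c (fun j : J => geoComap (geo9Y (f j)) (Prod.fst : (geo9Y (f j)).Site × TrIdx N → (geo9Y (f j)).Site))
      (fun j : J => (bg9YR (Matrix (Fin N) (Fin N) ℂ) (specialUnitaryUnits (Fin N)) R₁ R₂ (f j))) (fun j U => normMatY (trBasis N) (lamInvY (f j).toKIdx) (QGQOfQY (f j).toKIdx (𝔮 (f j)) (𝔮s (f j)) (T₀ (f j)) U))) :
    ∃ M₄ a₄ C δ₁ : ℝ, 0 < M₄ ∧ 0 < a₄ ∧ 0 < C ∧ 0 < δ₁ ∧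
      ∀ j : J, M₄ ≤ (geo9Y (f j)).M → ∀ α₀ : ℝ, 0 < α₀ → (geo9Y (f j)).M * α₀ ≤ a₄ →
        ∀ U : (bg9YR (Matrix (Fin N) (Fin N) ℂ) (specialUnitaryUnits (Fin N)) R₁ R₂ (f j)).Cfg, (bg9YR (Matrix (Fin N) (Fin N) ℂ) (specialUnitaryUnits (Fin N)) R₁ R₂ (f j)).Reg335 c α₀ U → (bg9YR (Matrix (Fin N) (Fin N) ℂ) (specialUnitaryUnits (Fin N)) R₁ R₂ (f j)).Reg336 c α₀ U →
          ∀ (n : Fin 2) (y y' : (geo9Y (f j)).Site),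
            (hKernelOfOp (f j).toKIdx (bg9YR (Matrix (Fin N) (Fin N) ℂ) (specialUnitaryUnits (Fin N)) R₁ R₂ (f j)) (fun U => U) (fun U => T₀ (f j) U ∘ₗ 𝔮s (f j) U ∘ₗ Ring.inverse (QGQOfQY (f j).toKIdx (𝔮 (f j)) (𝔮s (f j)) (T₀ (f j)) U)) (parH (f j))).e n U y y' ≤
              C * ((geo9Y (f j)).len y) ^ (-(n : ℝ)) * ((geo9Y (f j)).len y') ^ (-(((θ.d₆ + 1 : ℕ) : ℝ))) * Real.exp (-(δ₁ / 2 * (geo9Y (f j)).dist y y')) := by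
  -- ROW 26 at slot (a) along `f`: the (2.51) entry `he0` ⟹ `DecayUnder` (knit decay producer at `T := T₀`); + `hcoA` ⟹ Combes–Thomas ⟹ `B9.Stmt3132Printed`
  have hM01 : 0 < max M₀ 1 := lt_of_lt_of_le one_pos (le_max_right _ _)
  have hmaj0 : ∃ M₂ a₂ C δ : ℝ, 0 < M₂ ∧ 0 < a₂ ∧ 0 ≤ C ∧ 0 < δ ∧ ∀ j : J, M₂ ≤ (geo9Y (f j)).M → ∀ α₀ : ℝ, 0 < α₀ → (geo9Y (f j)).M * α₀ ≤ a₂ →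
      ∀ U : (bg9YR (Matrix (Fin N) (Fin N) ℂ) (specialUnitaryUnits (Fin N)) R₁ R₂ (f j)).Cfg, (bg9YR (Matrix (Fin N) (Fin N) ℂ) (specialUnitaryUnits (Fin N)) R₁ R₂ (f j)).Reg335 c α₀ U → (bg9YR (Matrix (Fin N) (Fin N) ℂ) (specialUnitaryUnits (Fin N)) R₁ R₂ (f j)).Reg336 c α₀ U →
        HasMajorant (g := toB6 (geo9Y (f j)) ((fun _ : MemberY θ.d₆ θ.ℓ₆ θ.hd' θ.hL' θ.b₀ θ.b₁ Mstar => (1 : ℝ)) (f j)) (H (f j))) (blkBK (f j).toKIdx (bI (f j)))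
          (GcoK (f j).toKIdx (trBasis N) (bg9YR (Matrix (Fin N) (Fin N) ℂ) (specialUnitaryUnits (Fin N)) R₁ R₂ (f j)) (fun U => U) (T₀ (f j)) U)
          (fun a a' => C * (geo9Y (f j)).len a ^ 2 * Real.exp (-(δ * (geo9Y (f j)).dist a a'))) :=
    ⟨max M₀ 1, a₀, B12₀, δ12₀, hM01, ha₀, hB12₀, hδ12₀, fun j hM α₀ hα ha U hU hU' => by
      have h := he0 (f j) ((le_max_left _ _).trans hM) α₀ hα ha U hU hU'
      rw [hblk12 (f j), hG0co12 (f j) U] at h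
      exact h⟩
  have hdec := N06Eq3132DecayFromMajorantKnitQJ.decayUnder_QGQOfQY_knit_of_majorants_R_J (f := f) R₁ R₂ specialUnitaryUnits_le_unitaryUnits (trBasis N) (trBasis N)
    T₀ 𝔮 𝔮s h𝔮 h𝔮s hc hRP hα' hαQ haK hKpl hlev hβ1 hnbr (R := fun _ => (1 : ℝ)) hmaj0
  obtain ⟨M₄, δ₁, a₄, C4, hM₄, hδ₁, ha₄, hC4, hall⟩ := B9Eq3132NuReadingRJ.stmt3132Printed_nu_of_coercive_decay_R_J (specialUnitaryUnits (Fin N)) R₁ R₂ (f := f) (trBasis N) (θ.d₆ + 1)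
    (fun (x : MemberY θ.d₆ θ.ℓ₆ θ.hd' θ.hL' θ.b₀ θ.b₁ Mstar) U => QGQOfQY x.toKIdx (𝔮 x) (𝔮s x) (T₀ x) U)
    (fun (x : MemberY θ.d₆ θ.ℓ₆ θ.hd' θ.hL' θ.b₀ θ.b₁ Mstar) U => QGQOfQY x.toKIdx (𝔮 x) (𝔮s x) (T₀ x) U) hcoA hdec hcoA hdec
  -- the common rate `δ⋆` and the derived rates
  set δs : ℝ := min δ12₀ (min δQ (δ₁ / 2)) with hδs
  have hδs0 : 0 < δs := lt_min hδ12₀ (lt_min hδQ (half_pos hδ₁))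
  have hδs12 : δs ≤ δ12₀ := min_le_left _ _
  have hδsQ : δs ≤ δQ := (min_le_right _ _).trans (min_le_left _ _)
  have hδs1 : δs ≤ δ₁ / 2 := (min_le_right _ _).trans (min_le_right _ _)
  -- [4] (2.61) at rate `δ⋆∕4`
  obtain ⟨ML, cr, hrow⟩ := rowSum261_geo9Y (d := θ.d₆) (ℓ := θ.ℓ₆) (hd := θ.hd') (hL := θ.hL') (b₀ := θ.b₀) (b₁ := θ.b₁) (Mstar := Mstar) (δs / 4) (by positivity)
  set c1 : ℝ := max cr 0 with hc1
  have hc10 : 0 ≤ c1 := le_max_right _ _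
  -- constants
  set L : ℝ := ((θ.ℓ₆ + 1 : ℕ) : ℝ) with hLdef
  have hL1 : (1 : ℝ) ≤ L := by rw [hLdef]; exact_mod_cast Nat.succ_le_succ (Nat.zero_le θ.ℓ₆)
  have hK1 : (1 : ℝ) ≤ 2 * ((θ.ℓ₆ : ℝ) + 1) ^ 2 - 1 := by nlinarith [(Nat.cast_nonneg θ.ℓ₆ : (0 : ℝ) ≤ θ.ℓ₆)]
  set Bz : ℝ := |cR39 (trBasis N)| * (‖((trBasis N).equivFunL : Matrix (Fin N) (Fin N) ℂ →L[ℝ] (TrIdx N → ℝ))‖ * ∑ a, ‖(trBasis N) a‖) * C4 * L ^ 2 with hBzdef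
  have hBz : 0 ≤ Bz := by rw [hBzdef]; positivity
  set B₃ : ℝ := max (B12₀ * BQ * c1) Bz with hB₃def
  have hB₃0 : 0 ≤ B₃ := le_max_of_le_right hBz
  set Λ : ℝ := L ^ |(2 : ℝ)| with hΛdef
  have hΛ0 : 0 ≤ Λ := by rw [hΛdef]; positivity
  -- thresholds: the class-letter gap and the (2.60) transfer at `α = ½`, rate `δ⋆∕4`
  set Mg : ℝ := 2 * Real.log L / ((δ₁ - δ₁ / 2) * (2 * ((θ.ℓ₆ : ℝ) + 1) ^ 2 - 1)) with hMg
  have hgden : 0 < (δ₁ - δ₁ / 2) * (2 * ((θ.ℓ₆ : ℝ) + 1) ^ 2 - 1) := mul_pos (by linarith) (by linarith)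
  set MT : ℝ := |(2 : ℝ)| * Real.log L / (1 / 2 * (δs / 4) * (2 * ((θ.ℓ₆ : ℝ) + 1) ^ 2 - 1)) with hMT
  have hTden : 0 < 1 / 2 * (δs / 4) * (2 * ((θ.ℓ₆ : ℝ) + 1) ^ 2 - 1) := mul_pos (by positivity) (by linarith)
  refine ⟨max (max (max M₀ 1) M12) (max M₄ (max ML (max Mg MT))), min a₀ (min a12 a₄), max (B₃ * B₃ * c1 * Λ) 1, 2 * ((1 - 1 / 2) * (δs / 4)),
    lt_of_lt_of_le one_pos ((le_max_right _ _).trans (le_max_left _ _ |>.trans (le_max_left _ _))), lt_min ha₀ (lt_min ha12 ha₄),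
    lt_of_lt_of_le one_pos (le_max_right _ _), by positivity, fun j hM α₀ hα ha U hU hU' n y y' => ?_⟩
  -- the member's thresholds and regimes
  have hM0 : M₀ ≤ (geo9Y (f j)).M := (le_max_left _ _).trans ((le_max_left _ _).trans ((le_max_left _ _).trans hM))
  have hM12' : M12 ≤ (geo9Y (f j)).M := (le_max_right _ _).trans ((le_max_left _ _).trans hM)
  have hM4 : M₄ ≤ (geo9Y (f j)).M := (le_max_left _ _).trans ((le_max_right _ _).trans hM)
  have hMLx : ML ≤ (geo9Y (f j)).M := (le_max_left _ _).trans ((le_max_right _ _).trans ((le_max_right _ _).trans hM))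
  have hMgx : Mg ≤ (geo9Y (f j)).M := (le_max_left _ _).trans ((le_max_right _ _).trans ((le_max_right _ _).trans ((le_max_right _ _).trans hM)))
  have hMTx : MT ≤ (geo9Y (f j)).M := (le_max_right _ _).trans ((le_max_right _ _).trans ((le_max_right _ _).trans ((le_max_right _ _).trans hM)))
  have ha0 : (geo9Y (f j)).M * α₀ ≤ a₀ := ha.trans (min_le_left _ _)
  have ha12' : (geo9Y (f j)).M * α₀ ≤ a12 := ha.trans ((min_le_right _ _).trans (min_le_left _ _))
  have ha4 : (geo9Y (f j)).M * α₀ ≤ a₄ := ha.trans ((min_le_right _ _).trans (min_le_right _ _))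
  -- the member's geometry facts
  have hG : GeoOK (geo9Y (f j)) := ⟨geo9Y_dist_triangle (f j), geo9Y_dist_comm (f j), geo9K_dist_nonneg (f j).toKIdx, geo9Y_len_pos (f j)⟩
  have hrowj : RowSum (toB6 (geo9Y (f j)) 1 (H (f j))) (δs / 4) c1 := fun yy => (hrow (f j) hMLx yy).trans (le_max_left _ _)
  have hN0 : 0 < N := Nat.pos_of_ne_zero (NeZero.ne N)
  have hcR : cR39 (trBasis N) ≠ 0 := (cR39_trBasis_pos hN0).ne'
  -- the three models at `(f j, U)`
  set G0m := GcoK (f j).toKIdx (trBasis N) (bg9YR (Matrix (Fin N) (Fin N) ℂ) (specialUnitaryUnits (Fin N)) R₁ R₂ (f j)) (fun U => U) (T₀ (f j)) U with hG0m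
  set Qsm := QscoKHq (f j).toKIdx (trBasis N) (bg9YR (Matrix (Fin N) (Fin N) ℂ) (specialUnitaryUnits (Fin N)) R₁ R₂ (f j)) (fun U => U) (𝔮s (f j)) U with hQsm
  set Dm := DcoK (f j).toKIdx (trBasis N) (bg9YR (Matrix (Fin N) (Fin N) ℂ) (specialUnitaryUnits (Fin N)) R₁ R₂ (f j)) (fun U => U) U with hDm
  set Cm : (XHK (TrIdx N) (f j).toKIdx → ℝ) →ₗ[ℝ] (XHK (TrIdx N) (f j).toKIdx → ℝ) :=
    cR39 (trBasis N) • coordOpK (trBasis N) (fun _ : Fin (θ.d₆ + 1) => (Ring.inverse (QGQOfQY (f j).toKIdx (𝔮 (f j)) (𝔮s (f j)) (T₀ (f j)) U)).restrictScalars ℝ) with hCm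
  -- the G₀ layer and the knit `Q⋆` letter at `(f j, U)`, read at the models
  have he0' := he0 (f j) hM0 α₀ hα ha0 U hU hU'
  have he1' := he1 (f j) hM0 α₀ hα ha0 U hU hU'
  have hqs' := hqsK (f j) hM12' α₀ hα ha12' U hU
  rw [hblk12 (f j), hG0co12 (f j) U] at he0'
  rw [hblk12 (f j), hblkY12 (f j), hDco12 (f j) U, hG0co12 (f j) U] at he1'
  rw [hblkZ12 (f j), hblk12 (f j), hQsco12q (f j) U] at hqs'
  -- `gQs2♭`, `dgQs♭` at rate `δ⋆∕2`, constant `B₃`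
  have hδ30 : 0 ≤ δs / 2 := by positivity
  have hδ312 : δs / 2 ≤ δ12₀ := by linarith
  have hδ3Q : δs / 2 + δs / 4 ≤ δQ := by linarith
  have hB₃le : B12₀ * BQ * c1 ≤ B₃ := le_max_left _ _
  have hgQs2 := gQs2_of_e0 hG hrowj hB12₀ hBQ hc10 hδ30 hδ312 hδ3Q hB₃le he0' hqs'
  have hdgQs := dgQs_of_e1 hG hrowj hB12₀ hBQ hc10 hδ30 hδ312 hδ3Q hB₃le he1' hqs'
  -- `c2♭`: ROW 26♭ ⟹ the class letter, weakened to `(B₃, δ⋆∕2)`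
  have hgap' : 2 * Real.log (((θ.ℓ₆ + 1 : ℕ) : ℝ)) ≤ (δ₁ - δ₁ / 2) * (2 * ((θ.ℓ₆ : ℝ) + 1) ^ 2 - 1) * (geo9Y (f j)).M := by
    have h0 := hMgx
    rw [hMg, div_le_iff₀ hgden, hLdef] at h0
    simpa [mul_comm, mul_left_comm, mul_assoc] using h0
  have hconv := hasMaj_cNorm_weightNorm_coordOpK_geo9Y_of_ineq3132Nu (trBasis N) (f j) (bg9YR (Matrix (Fin N) (Fin N) ℂ) (specialUnitaryUnits (Fin N)) R₁ R₂ (f j)) (fun U => U)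
    (fun U => Ring.inverse (QGQOfQY (f j).toKIdx (𝔮 (f j)) (𝔮s (f j)) (T₀ (f j)) U))
    (norm_nonneg _) (abs_repr_le (trBasis N)) 1 (H (f j)) (cR39 (trBasis N)) U (fun y => (geo9Y_len_pos (f j) y).le) (fun y => (plateau_pos (f j).toKIdx y).le)
    hC4.le (half_lt_self hδ₁) hgap' (hall j hM4 α₀ hα ha4 U hU hU').1
  have hc2 : HasMaj (cNorm 1 (H (f j)) (blkHK (f j).toKIdx) hG.lenle 2)
      (weightNorm (BlockNorm.ofBlocks (toB6 (geo9Y (f j)) 1 (H (f j))) (blkHK (f j).toKIdx)) (fun y => ((((θ.ℓ₆ + 1 : ℕ) : ℝ) ^ (θ.d₆ + 1)) ^ lvl (f j).hN (f j).D (f j).hk y)⁻¹) (fun y => (plateau_pos (f j).toKIdx y).le))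
      Cm (fun a b => B₃ * Real.exp (-(δs / 2 * (geo9Y (f j)).dist a b))) := by
    refine hconv.mono fun a b' => ?_
    have hd : 0 ≤ (geo9Y (f j)).dist a b' := geo9K_dist_nonneg (f j).toKIdx a b'
    have hexp : Real.exp (-(δ₁ / 2 * (geo9Y (f j)).dist a b')) ≤ Real.exp (-(δs / 2 * (geo9Y (f j)).dist a b')) :=
      Real.exp_le_exp.mpr (neg_le_neg (mul_le_mul_of_nonneg_right (by linarith) hd))
    have hBz' : |cR39 (trBasis N)| * (‖((trBasis N).equivFunL : Matrix (Fin N) (Fin N) ℂ →L[ℝ] (TrIdx N → ℝ))‖ * ∑ a, ‖(trBasis N) a‖) * C4 *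
        (((θ.ℓ₆ + 1 : ℕ) : ℝ)) ^ 2 ≤ B₃ := le_max_right _ _
    calc _ ≤ B₃ * Real.exp (-(δ₁ / 2 * (geo9Y (f j)).dist a b')) := mul_le_mul_of_nonneg_right hBz' (Real.exp_nonneg _)
      _ ≤ B₃ * Real.exp (-(δs / 2 * (geo9Y (f j)).dist a b')) := mul_le_mul_of_nonneg_left hexp hB₃0
  -- the model identity `HcoK(H♭) = G0m ∘ Qsm ∘ Cm` and the two relative co-readings
  have hHm : HcoK (f j).toKIdx (trBasis N) (bg9YR (Matrix (Fin N) (Fin N) ℂ) (specialUnitaryUnits (Fin N)) R₁ R₂ (f j)) (fun U => U) (fun U => T₀ (f j) U ∘ₗ 𝔮s (f j) U ∘ₗ Ring.inverse (QGQOfQY (f j).toKIdx (𝔮 (f j)) (𝔮s (f j)) (T₀ (f j)) U)) U = G0m ∘ₗ Qsm ∘ₗ Cm := by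
    rw [hG0m, hQsm, hCm, HcoK, GcoK, QscoKHq, smul_comp_smul', smul_comp_smul', inv_mul_cancel₀ hcR, mul_one, coordOpKH_const_comp_coordOpK_const,
      coordOpK_const_comp_coordOpKH_const]
    rfl
  have hC0 := coRealizesHRel_hKernel_coords_zero (f j).toKIdx (trBasis N) (bg9YR (Matrix (Fin N) (Fin N) ℂ) (specialUnitaryUnits (Fin N)) R₁ R₂ (f j)) (fun U => U) (fun U => T₀ (f j) U ∘ₗ 𝔮s (f j) U ∘ₗ Ring.inverse (QGQOfQY (f j).toKIdx (𝔮 (f j)) (𝔮s (f j)) (T₀ (f j)) U)) (parH (f j)) U (hβI (f j))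
  have hC1 := coRealizesHRel_hKernel_coords_one (f j).toKIdx (trBasis N) (bg9YR (Matrix (Fin N) (Fin N) ℂ) (specialUnitaryUnits (Fin N)) R₁ R₂ (f j)) (fun U => U) (fun U => T₀ (f j) U ∘ₗ 𝔮s (f j) U ∘ₗ Ring.inverse (QGQOfQY (f j).toKIdx (𝔮 (f j)) (𝔮s (f j)) (T₀ (f j)) U)) (parH (f j)) U (hβI (f j))
  rw [hHm] at hC0 hC1
  -- (2.60) at `α = ½`, rate `δ⋆∕4`, weight `(Lʲη)²`
  have hMT' : |(2 : ℝ)| * Real.log (geo9Y (f j)).L ≤ 1 / 2 * (δs / 4) * (2 * ((θ.ℓ₆ : ℝ) + 1) ^ 2 - 1) * (geo9Y (f j)).M := by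
    have h0 := hMTx
    rw [hMT, div_le_iff₀ hTden] at h0
    have hLx : (geo9Y (f j)).L = L := rfl
    rw [hLx]; linarith [h0]
  have hST := scaleTransfer_rpow_geo9Y (f j) (δ := δs / 4) (α := 1 / 2) (by positivity) 2 hMT'
  -- assembly (P-H♭ F1Z)
  have hκ : (weightNorm (BlockNorm.ofBlocks (toB6 (geo9Y (f j)) 1 (H (f j))) (blkHK (κ := TrIdx N) (f j).toKIdx))
      (fun y => ((((θ.ℓ₆ + 1 : ℕ) : ℝ) ^ (θ.d₆ + 1)) ^ lvl (f j).hN (f j).D (f j).hk y)⁻¹) (fun y => (plateau_pos (f j).toKIdx y).le)).κ = 1 := rfl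
  have hρ₃ : δs / 4 + δs / 4 ≤ δs / 2 := by linarith
  have key := ineq3133flat_sup_of_lettersZ_rel (X := XBK (TrIdx N) (f j).toKIdx) (Y := XBK (TrIdx N) (f j).toKIdx) (Z := XHK (TrIdx N) (f j).toKIdx) hG (Hk := hKernelOfOp (f j).toKIdx (bg9YR (Matrix (Fin N) (Fin N) ℂ) (specialUnitaryUnits (Fin N)) R₁ R₂ (f j)) (fun U => U) (fun U => T₀ (f j) U ∘ₗ 𝔮s (f j) U ∘ₗ Ring.inverse (QGQOfQY (f j).toKIdx (𝔮 (f j)) (𝔮s (f j)) (T₀ (f j)) U)) (parH (f j))) (d := θ.d₆ + 1)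
    hrowj hκ hB₃0 (by positivity) (by positivity) hρ₃ hc10 hΛ0
    (fun a a' b h => dist_eq_of_relB (f j).toKIdx h (relB_refl (f j).toKIdx b)) (fun a a' h => len_eq_of_relB (f j).toKIdx h)
    hgQs2 hdgQs hc2 hC0 hC1 hST n y y'
  refine key.trans ?_
  have h1 : 0 ≤ ((geo9Y (f j)).len y) ^ (-(n : ℝ)) := Real.rpow_nonneg (geo9Y_len_pos (f j) y).le _
  have h2 : 0 ≤ ((geo9Y (f j)).len y') ^ (-(((θ.d₆ + 1 : ℕ) : ℝ))) := Real.rpow_nonneg (geo9Y_len_pos (f j) y').le _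
  exact mul_le_mul_of_nonneg_right (mul_le_mul_of_nonneg_right (mul_le_mul_of_nonneg_right (le_max_left _ _) h1) h2) (Real.exp_nonneg _)

end Summit.QuantumFields.YangMills.BalabanUVNodes.N06Ineq3133SlotAAtPinsKnitQJ

end
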